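import Literature.Barriers.BirchSwinnertonDyer.RankNotSumOfLocalInvariants
import Literature.NumberTheory.EllipticCurves.BSDAnalyticRank
import Literature.NumberTheory.EllipticCurves.QuadraticTwistPadicReduction
import Literature.NumberTheory.EllipticCurves.KramerDescentLocalGeneratorsProofs
import HarnessLib

/-!
# Rank mod `4` over the fixed field `ℚ`: eight congruent number curves form `4`-blocks at every place

Companion to `Literature/Barriers/BirchSwinnertonDyer/RankNotSumOfLocalInvariants.lean`, whose
NARROWED record
`Literature.Barriers.BirchSwinnertonDyer.DokchitserDokchitser2011_rankMod_notSumOfLocalInvariantsNarrow`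
has as conjunct (2) the fixed-base-field statement "`rk E(ℚ) mod 4` is not a sum over the places
of `ℚ` of local invariants" (`¬ IsSumOfLocalInvariantsOver ℚ (fun W ↦ (W.mordellWeilRank : ZMod 4))`).
Its printed proof is Lemma 5 of T. Dokchitser–V. Dokchitser, *A note on the Mordell–Weil rank
modulo `n`*, J. Number Theory 131 (2011) 1833–1839 — over a FIXED number field `K`, for a
multi-quadratic `F = K(√α_1, …, √α_m)/K` in which every prime of `K` splits into a multiple of
`2^k` primes, `Λ(E/K) + Σ_D Λ(E_D/K) = 0` for every `ℤ/2^kℤ`-valued sum of local invariants `Λ`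
("in the local expression for the left-hand side each local term occurs a multiple of `2^k`
times") — applied in print with `E = 480a1`, `F = F₄ = ℚ(√-1, √41, √73)`, `rk E(F₄) = 6` (Magma).
The barrier file proves the abstract counting form of Lemma 5
(`not_isSumOfLocalInvariantsOver_of_blocks`); the sequel
`RankNotSumOfLocalInvariantsNarrowProofs.lean` derives conjunct (2) from the named `F₄` descent
leaf. To prove conjunct (2) UNCONDITIONALLY one may use ANY elliptic curve over `ℚ` and any
multi-quadratic `F/ℚ` with the splitting property whose eight twists have computable ranks of
sum `≢ 0 (mod 4)`. This file sets up such an instance, chosen so that all eight ranks follow from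
complete `2`-descents over `ℚ` (sequel files `RankNotSumOfLocalInvariantsCNRanks*.lean`):

* the base curve is the congruent number curve `E = E₁ : y² = x³ - x` (tree
  `congruentNumberCurve 1`, good reduction outside `2`), and
  `F = ℚ(√-6, √-15, √-159)`: the eight classes `d(D) ∈ V = ⟨-6, -15, -159⟩ ⊂ ℚ^×/ℚ^{×2}` are
  `{1, -6, -15, -159, 10, 106, 265, -1590}` (`cnParam`), and the twists
  `E^{(d)} : y² = x³ - d²x` (`cnTwist`, the tree's `quadraticTwist`) are the congruent number curves
  `E_1, E_6, E_15, E_159, E_10, E_106, E_265, E_1590`, of ranks `0, 1, 1, 1, 0, 0, 2, 1` (sum `6`);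
* at every place `v` of `ℚ` the image of `V` in `ℚ_v^×/ℚ_v^{×2}` has order `≤ 2`, i.e. some
  character `χ_c` of the index group `(ℤ/2)³` has kernel consisting of local squares — at `2` the
  odd classes `1, -15, -159, 265 ≡ 1 (mod 8)`; at `3` the classes prime to `3`
  (`10, 106, 265 ≡ 1 (mod 3)`); at `5`: `-6 ≡ 2², -159 ≡ 1, 106 ≡ 1`; at `53`: `-6 ≡ 10²`,
  `-15 ≡ 12²`, `10 ≡ 13²`; at the other odd primes the kernel of the Legendre character; at `∞`
  the positive classes (`cn_padic_ker_isSquare`, `cn_real_ker_isSquare`) — so every place of `ℚ`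
  splits into `4` or `8` places of `F`, the hypothesis of Lemma 5 with `2^k = 4`;
* hence over any field `L ⊇ ℚ` with this property the eight twists fall into blocks of
  `L`-isomorphic curves of size divisible by `4` (`cn_exists_blocks`; `E^{(d)} ≅ E^{(d')}` over `L`
  when `dd' ∈ L^{×2}`, tree `WeierstrassCurve.exists_variableChange_quadraticTwist_mul_sq`,
  Silverman AEC X.5.4).

All combinatorics of the index group is settled by `decide`. Design as in
`RankNotSumOfLocalInvariantsNarrowTwists.lean` (the `480a1`/`F₄` instance).

## References

* T. Dokchitser, V. Dokchitser, *A note on the Mordell–Weil rank modulo `n`*, J. Number Theory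
  131 (2011) 1833–1839, arXiv:0910.4588: Lemma 5 with proof, proof of Thm. 2 (p. 3 of the held
  arXiv copy). [DokchitserDokchitser2011RankModN]
* J. H. Silverman, *The Arithmetic of Elliptic Curves*, 2nd ed., GTM 106 (2009): X.5 Prop. 5.4 and
  Cor. 5.4.1 (twists `E_D`, `D mod (K^*)^2`). [SilvermanAEC2009]
* J.-P. Serre, *A Course in Arithmetic* (1973), Ch. II §3.3 Thms. 3–4 (squares in `ℚ_p`), through
  the tree lemmas of `KramerDescentLocalGeneratorsProofs.lean`. [Serre1973]
-/

noncomputable section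

namespace Literature.Barriers.BirchSwinnertonDyer

namespace CongruentDescent

open WeierstrassCurve Literature.NumberTheory.EllipticCurves

/-! ### The index group `V = ⟨-6, -15, -159⟩ ≅ (ℤ/2)³` and the twisting parameters -/

/-- Index set of the eight quadratic twists: exponent vectors `(a, b, c)` of `-6, -15, -159`.
[cite: DokchitserDokchitser2011RankModN, Lemma 5] -/
abbrev CNIdx : Type := Fin 2 × Fin 2 × Fin 2

/-- The twisting parameter `d(a, b, c)`: the square-free part of `(-6)^a (-15)^b (-159)^c`, one of
`1, -159, -15, 265, -6, 106, 10, -1590`. [cite: DokchitserDokchitser2011RankModN, Lemma 5] -/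
def cnParam : CNIdx → ℤ
  | (0, 0, 0) => 1
  | (0, 0, 1) => -159
  | (0, 1, 0) => -15
  | (0, 1, 1) => 265
  | (1, 0, 0) => -6
  | (1, 0, 1) => 106
  | (1, 1, 0) => 10
  | (1, 1, 1) => -1590

/-- The square factor removed: `d(D) · f(D)² = (-6)^a (-15)^b (-159)^c`. [folklore] -/
def cnSqf : CNIdx → ℤ
  | (a, b, c) => if a.val + b.val + c.val ≥ 2 then 3 else 1

/-- `d(D) f(D)² = (-6)^a (-15)^b (-159)^c`. [folklore] -/
theorem cnParam_mul_sq (D : CNIdx) :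
    cnParam D * cnSqf D ^ 2 = (-6) ^ D.1.val * (-15) ^ D.2.1.val * (-159) ^ D.2.2.val := by
  revert D; decide

/-- The square root of `d(D) d(D') / d(D + D')`. [folklore] -/
def cnSqFactor (D D' : CNIdx) : ℤ :=
  ((-6) ^ (D.1.val * D'.1.val) * (-15) ^ (D.2.1.val * D'.2.1.val) * (-159) ^ (D.2.2.val * D'.2.2.val)
    * cnSqf (D + D')) / (cnSqf D * cnSqf D')

/-- `d` is a homomorphism to `ℚ^×/ℚ^{×2}`: `d(D) d(D') = d(D + D') · (square)`. [folklore] -/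
theorem cnParam_mul_cnParam (D D' : CNIdx) :
    cnParam D * cnParam D' = cnParam (D + D') * cnSqFactor D D' ^ 2 := by
  revert D D'; decide

/-- `d(D) ≠ 0`. [folklore] -/
theorem cnParam_ne_zero (D : CNIdx) : cnParam D ≠ 0 := by
  revert D; decide

/-- The `𝔽₂`-valued character `χ_c(D) = c · D` of the index group. [folklore] -/
def cnChi (c D : CNIdx) : Fin 2 := c.1 * D.1 + c.2.1 * D.2.1 + c.2.2 * D.2.2

/-- A fixed element outside `ker χ_c` (when `c ≠ 0`). [folklore] -/
def cnBlockRep (c : CNIdx) : CNIdx :=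
  if c.1 = 1 then (1, 0, 0) else if c.2.1 = 1 then (0, 1, 0) else (0, 0, 1)

/-- The block map of `χ_c`: collapses `ker χ_c` to `0` and its complement to `cnBlockRep c`.
[cite: DokchitserDokchitser2011RankModN, Lemma 5 (proof)] -/
def cnBlockMap (c D : CNIdx) : CNIdx := if cnChi c D = 0 then 0 else cnBlockRep c

/-- Every fibre of a block map has cardinality divisible by `4`.
[cite: DokchitserDokchitser2011RankModN, Lemma 5 (proof)] -/
theorem four_dvd_card_filter_cnBlockMap (c j : CNIdx) :
    4 ∣ (Finset.univ.filter fun D ↦ cnBlockMap c D = j).card := by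
  revert c j; decide

/-- `D` and its block representative differ by an element of `ker χ_c`. [folklore] -/
theorem cnChi_add_cnBlockMap (c D : CNIdx) : cnChi c (D + cnBlockMap c D) = 0 := by
  revert c D; decide

/-! ### The eight twists of `E₁ : y² = x³ - x` and their local isomorphisms -/

/-- **The eight quadratic twists `E^{(d)} : y² = x³ - d²x` of `E₁ = congruentNumberCurve 1`**,
`d = d(D) ∈ {1, -6, -15, -159, 10, 106, 265, -1590}` — the curves `E_D` of Lemma 5 of
Dokchitser–Dokchitser (2011) for `K = ℚ`, `F = ℚ(√-6, √-15, √-159)`, `E = E₁`.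
[cite: DokchitserDokchitser2011RankModN, Lemma 5] -/
def cnTwist (D : CNIdx) : WeierstrassCurve ℚ :=
  (congruentNumberCurve 1).quadraticTwist (cnParam D : ℚ)

/-- `E₁` is an elliptic curve. [folklore] -/
instance isElliptic_cn_one : (congruentNumberCurve 1).IsElliptic :=
  isElliptic_congruentNumberCurve one_ne_zero

/-- Each twist is an elliptic curve (`Δ(E^{(d)}) = d⁶ Δ(E₁) ≠ 0`). [folklore] -/
instance cnTwist.instIsElliptic (D : CNIdx) : (cnTwist D).IsElliptic :=
  isElliptic_quadraticTwist _ (by exact_mod_cast cnParam_ne_zero D)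

section Blocks

variable {L : Type*} [Field L]

/-- Base change of a twist is the twist of the base change. [folklore] -/
theorem cnTwist_baseChange [Algebra ℚ L] (D : CNIdx) :
    (cnTwist D).baseChange L =
      ((congruentNumberCurve 1).baseChange L).quadraticTwist (cnParam D : L) := by
  rw [cnTwist, baseChange, map_quadraticTwist, map_intCast]
  rfl

/-- A non-zero integer is non-zero in a field containing `ℚ`. [folklore] -/
theorem intCast_ne_zero_of_ne_zero' [Algebra ℚ L] {n : ℤ} (hn : n ≠ 0) : (n : L) ≠ 0 := by
  rw [← map_intCast (algebraMap ℚ L), map_ne_zero]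
  exact_mod_cast hn

/-- **`E^{(d)} ≅ E^{(d')}` over `L` when `d d' ∈ L^{×2}`** (Silverman AEC X.5.4, easy half; tree
`WeierstrassCurve.exists_variableChange_quadraticTwist_mul_sq`). [cite: SilvermanAEC2009, X.5 Prop. 5.4] -/
theorem cn_exists_variableChange_of_isSquare [Algebra ℚ L] (D D' : CNIdx)
    (h : IsSquare ((cnParam D * cnParam D' : ℤ) : L)) :
    ∃ C : VariableChange L, C • (cnTwist D).baseChange L = (cnTwist D').baseChange L := by
  obtain ⟨s, hs⟩ := h
  have hd : (cnParam D : L) ≠ 0 := intCast_ne_zero_of_ne_zero' (cnParam_ne_zero D)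
  have hd' : (cnParam D' : L) ≠ 0 := intCast_ne_zero_of_ne_zero' (cnParam_ne_zero D')
  have hs0 : s ≠ 0 := by
    rintro rfl
    rw [mul_zero, Int.cast_mul] at hs
    exact mul_ne_zero hd hd' hs
  obtain ⟨C, hC⟩ := ((congruentNumberCurve 1).baseChange L).exists_variableChange_quadraticTwist_mul_sq
    (cnParam D : L) (s / cnParam D) (div_ne_zero hs0 hd)
  refine ⟨C, ?_⟩
  rw [cnTwist_baseChange, cnTwist_baseChange, hC]
  congr 1
  rw [Int.cast_mul] at hs
  field_simp
  linear_combination (-1 : L) * hs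

/-- If `d` is a square in `L` on the kernel of `χ_c`, then `d(D) · d(block representative of D)`
is a square in `L`. [folklore] -/
theorem cn_isSquare_mul_of_ker (c : CNIdx)
    (hker : ∀ D, cnChi c D = 0 → IsSquare ((cnParam D : ℤ) : L)) (D : CNIdx) :
    IsSquare ((cnParam D * cnParam (cnBlockMap c D) : ℤ) : L) := by
  obtain ⟨s, hs⟩ := hker _ (cnChi_add_cnBlockMap c D)
  refine ⟨s * cnSqFactor D (cnBlockMap c D), ?_⟩
  rw [cnParam_mul_cnParam, Int.cast_mul, hs]
  push_cast
  ring

/-- **Local `4`-blocks.** Over a field `L ⊇ ℚ` in which `d(D)` is a square for every `D` in the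
kernel of some character `χ_c`, the eight twists fall into blocks of `L`-isomorphic curves of size
divisible by `4` (hence by any `n ∣ 4`) — the local input of Lemma 5 ("each local term occurs a
multiple of `2^k` times") in the format of
`Literature.Barriers.BirchSwinnertonDyer.not_isSumOfLocalInvariantsOver_of_blocks`.
[cite: DokchitserDokchitser2011RankModN, Lemma 5 (proof)] -/
theorem cn_exists_blocks [Algebra ℚ L] {n : ℕ} (hn : n ∣ 4)
    (h : ∃ c : CNIdx, ∀ D, cnChi c D = 0 → IsSquare ((cnParam D : ℤ) : L)) :
    ∃ m : CNIdx → CNIdx,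
      (∀ D, ∃ C : VariableChange L, C • (cnTwist D).baseChange L = (cnTwist (m D)).baseChange L) ∧
      ∀ j, n ∣ (Finset.univ.filter fun D ↦ m D = j).card := by
  obtain ⟨c, hc⟩ := h
  exact ⟨cnBlockMap c, fun D ↦ cn_exists_variableChange_of_isSquare D _
    (cn_isSquare_mul_of_ker c hc D), fun j ↦ hn.trans (four_dvd_card_filter_cnBlockMap c j)⟩

end Blocks

/-! ### Local squares: `ℚ_p` for every prime `p`, and `ℝ` -/

section Padic

open Literature.NumberTheory.EllipticCurves.KramerLocal

/-- The Legendre symbol is multiplicative in powers. [folklore] -/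
theorem legendreSym_pow' (p : ℕ) [Fact p.Prime] (a : ℤ) (n : ℕ) :
    legendreSym p (a ^ n) = legendreSym p a ^ n := by
  induction n with
  | zero => simp [legendreSym.at_one]
  | succ n ih => rw [pow_succ, legendreSym.mul, ih, pow_succ]

/-- The bit of a sign: `1 ↦ 0`, `-1 ↦ 1`. [folklore] -/
def cnSignBit (s : ℤ) : Fin 2 := if s = -1 then 1 else 0

/-- An integer whose prime factors are among `2, 3, 5, 53` is a unit modulo any other prime.
[folklore] -/
theorem intCast_zmod_ne_zero_of_ne {p : ℕ} [hp : Fact p.Prime] (hp2 : p ≠ 2) (hp3 : p ≠ 3)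
    (hp5 : p ≠ 5) (hp53 : p ≠ 53) {m : ℤ} (hm : m ∈ ({-1, 2, 3, 5, 53} : Finset ℤ)) :
    (m : ZMod p) ≠ 0 := by
  have key : ∀ q : ℕ, q.Prime → p ≠ q → ((q : ℤ) : ZMod p) ≠ 0 := by
    intro q hq hpq
    rw [Ne, ZMod.intCast_zmod_eq_zero_iff_dvd, Int.natCast_dvd_natCast,
      Nat.prime_dvd_prime_iff_eq hp.out hq]
    exact hpq
  simp only [Finset.mem_insert, Finset.mem_singleton] at hm
  rcases hm with rfl | rfl | rfl | rfl | rfl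
  · rw [Int.cast_neg, Int.cast_one]; exact neg_ne_zero.mpr one_ne_zero
  · exact key 2 Nat.prime_two hp2
  · exact key 3 Nat.prime_three hp3
  · exact key 5 (by norm_num) hp5
  · exact key 53 (by norm_num) hp53

/-- **Odd `p ∉ {3, 5, 53}`**: the kernel of the Legendre character
`D ↦ (d(D)/p) = (-6/p)^a (-15/p)^b (-159/p)^c` consists of `D` with `d(D)` a non-zero square mod
`p`, hence a square in `ℚ_p` (Hensel; tree `KramerLocal.padic_isSquare_intCast`).
[cite: Serre1973, Ch. II §3.3 Thm 3] -/
theorem cn_padic_ker_isSquare_of_ne (p : ℕ) [hp : Fact p.Prime] (hp2 : p ≠ 2) (hp3 : p ≠ 3)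
    (hp5 : p ≠ 5) (hp53 : p ≠ 53) :
    ∃ c : CNIdx, ∀ D, cnChi c D = 0 → IsSquare ((cnParam D : ℤ) : ℚ_[p]) := by
  have hm1 := intCast_zmod_ne_zero_of_ne hp2 hp3 hp5 hp53 (m := -1) (by simp)
  have h2 := intCast_zmod_ne_zero_of_ne hp2 hp3 hp5 hp53 (m := 2) (by simp)
  have h3 := intCast_zmod_ne_zero_of_ne hp2 hp3 hp5 hp53 (m := 3) (by simp)
  have h5 := intCast_zmod_ne_zero_of_ne hp2 hp3 hp5 hp53 (m := 5) (by simp)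
  have h53 := intCast_zmod_ne_zero_of_ne hp2 hp3 hp5 hp53 (m := 53) (by simp)
  have h6' : ((-6 : ℤ) : ZMod p) ≠ 0 := by
    rw [show (-6 : ℤ) = -1 * 2 * 3 by norm_num, Int.cast_mul, Int.cast_mul]
    exact mul_ne_zero (mul_ne_zero hm1 h2) h3
  have h15' : ((-15 : ℤ) : ZMod p) ≠ 0 := by
    rw [show (-15 : ℤ) = -1 * 3 * 5 by norm_num, Int.cast_mul, Int.cast_mul]
    exact mul_ne_zero (mul_ne_zero hm1 h3) h5
  have h159' : ((-159 : ℤ) : ZMod p) ≠ 0 := by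
    rw [show (-159 : ℤ) = -1 * 3 * 53 by norm_num, Int.cast_mul, Int.cast_mul]
    exact mul_ne_zero (mul_ne_zero hm1 h3) h53
  have hsqf : ∀ D, ((cnSqf D : ℤ) : ZMod p) ≠ 0 := by
    intro D
    have : cnSqf D = 3 ∨ cnSqf D = 1 := by revert D; decide
    rcases this with h | h <;> rw [h]
    · exact h3
    · rw [Int.cast_one]; exact one_ne_zero
  refine ⟨(cnSignBit (legendreSym p (-6)), cnSignBit (legendreSym p (-15)),
    cnSignBit (legendreSym p (-159))), fun D hD ↦ ?_⟩
  -- `d(D)` is a unit mod `p`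
  have hprod : ((cnParam D * cnSqf D ^ 2 : ℤ) : ZMod p) ≠ 0 := by
    rw [cnParam_mul_sq, Int.cast_mul, Int.cast_mul, Int.cast_pow, Int.cast_pow, Int.cast_pow]
    exact mul_ne_zero (mul_ne_zero (pow_ne_zero _ h6') (pow_ne_zero _ h15')) (pow_ne_zero _ h159')
  have hD0 : ((cnParam D : ℤ) : ZMod p) ≠ 0 := by
    intro h0; apply hprod; rw [Int.cast_mul, h0, zero_mul]
  apply padic_isSquare_intCast hp2 hD0
  rw [← legendreSym.eq_one_iff p hD0]
  -- Legendre symbol of `d(D)` from `d(D) f(D)² = (-6)^a (-15)^b (-159)^c`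
  have key : legendreSym p (cnParam D) =
      legendreSym p (-6) ^ D.1.val * legendreSym p (-15) ^ D.2.1.val *
        legendreSym p (-159) ^ D.2.2.val := by
    have h := congrArg (legendreSym p) (cnParam_mul_sq D)
    rw [legendreSym.mul p (cnParam D), legendreSym.sq_one' p (hsqf D), mul_one,
      legendreSym.mul p ((-6) ^ D.1.val * (-15) ^ D.2.1.val), legendreSym.mul p ((-6) ^ D.1.val),
      legendreSym_pow', legendreSym_pow', legendreSym_pow'] at h
    exact h
  rw [key]
  clear key hD0 hprod
  rcases legendreSym.eq_one_or_neg_one p h6' with h1 | h1 <;>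
  rcases legendreSym.eq_one_or_neg_one p h15' with h2 | h2 <;>
  rcases legendreSym.eq_one_or_neg_one p h159' with h3 | h3 <;>
  · rw [h1, h2, h3] at hD ⊢
    revert D
    decide

/-- Residues modulo `3`: `10 ≡ 106 ≡ 265 ≡ 1²` are non-zero squares. [folklore] -/
theorem cn_zmod3_squares :
    (((10 : ℤ) : ZMod 3) ≠ 0 ∧ IsSquare ((10 : ℤ) : ZMod 3)) ∧
      (((106 : ℤ) : ZMod 3) ≠ 0 ∧ IsSquare ((106 : ℤ) : ZMod 3)) ∧
      (((265 : ℤ) : ZMod 3) ≠ 0 ∧ IsSquare ((265 : ℤ) : ZMod 3)) := by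
  refine ⟨⟨by decide, ⟨1, by decide⟩⟩, ⟨by decide, ⟨1, by decide⟩⟩, ⟨by decide, ⟨1, by decide⟩⟩⟩

/-- Residues modulo `5`: `-6 ≡ 2²`, `-159 ≡ 1²`, `106 ≡ 1²` are non-zero squares. [folklore] -/
theorem cn_zmod5_squares :
    (((-6 : ℤ) : ZMod 5) ≠ 0 ∧ IsSquare ((-6 : ℤ) : ZMod 5)) ∧
      (((-159 : ℤ) : ZMod 5) ≠ 0 ∧ IsSquare ((-159 : ℤ) : ZMod 5)) ∧
      (((106 : ℤ) : ZMod 5) ≠ 0 ∧ IsSquare ((106 : ℤ) : ZMod 5)) := by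
  refine ⟨⟨by decide, ⟨2, by decide⟩⟩, ⟨by decide, ⟨1, by decide⟩⟩, ⟨by decide, ⟨1, by decide⟩⟩⟩

/-- Residues modulo `53`: `-6 ≡ 10²`, `-15 ≡ 12²`, `10 ≡ 13²` are non-zero squares. [folklore] -/
theorem cn_zmod53_squares :
    (((-6 : ℤ) : ZMod 53) ≠ 0 ∧ IsSquare ((-6 : ℤ) : ZMod 53)) ∧
      (((-15 : ℤ) : ZMod 53) ≠ 0 ∧ IsSquare ((-15 : ℤ) : ZMod 53)) ∧
      (((10 : ℤ) : ZMod 53) ≠ 0 ∧ IsSquare ((10 : ℤ) : ZMod 53)) := by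
  refine ⟨⟨by decide, ⟨10, by decide⟩⟩, ⟨by decide, ⟨12, by decide⟩⟩, ⟨by decide, ⟨13, by decide⟩⟩⟩

/-- **`p = 3`**: the kernel `{1, 10, 106, 265}` of `χ_{(1,1,1)}` (the classes prime to `3`)
consists of squares in `ℚ₃` (`10 ≡ 106 ≡ 265 ≡ 1 mod 3`; Hensel). [cite: Serre1973, Ch. II §3.3 Thm 3] -/
theorem cn_padic_ker_isSquare_3 [Fact (Nat.Prime 3)] :
    ∃ c : CNIdx, ∀ D, cnChi c D = 0 → IsSquare ((cnParam D : ℤ) : ℚ_[3]) := by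
  obtain ⟨⟨h1, h1'⟩, ⟨h2, h2'⟩, ⟨h3, h3'⟩⟩ := cn_zmod3_squares
  refine ⟨(1, 1, 1), fun D hD ↦ ?_⟩
  have hsq : ∀ n : ℤ, n ∈ ({1, 10, 106, 265} : Finset ℤ) → IsSquare ((n : ℤ) : ℚ_[3]) := by
    intro n hn
    simp only [Finset.mem_insert, Finset.mem_singleton] at hn
    rcases hn with rfl | rfl | rfl | rfl
    · exact ⟨1, by norm_num⟩
    · exact padic_isSquare_intCast (by norm_num) h1 h1'
    · exact padic_isSquare_intCast (by norm_num) h2 h2'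
    · exact padic_isSquare_intCast (by norm_num) h3 h3'
  apply hsq
  revert D
  decide

/-- **`p = 5`**: the kernel `{1, -6, -159, 106}` of `χ_{(0,1,0)}` consists of squares in `ℚ₅`
(`-6 ≡ 2², -159 ≡ 1, 106 ≡ 1 mod 5`; Hensel). [cite: Serre1973, Ch. II §3.3 Thm 3] -/
theorem cn_padic_ker_isSquare_5 [Fact (Nat.Prime 5)] :
    ∃ c : CNIdx, ∀ D, cnChi c D = 0 → IsSquare ((cnParam D : ℤ) : ℚ_[5]) := by
  obtain ⟨⟨h1, h1'⟩, ⟨h2, h2'⟩, ⟨h3, h3'⟩⟩ := cn_zmod5_squares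
  refine ⟨(0, 1, 0), fun D hD ↦ ?_⟩
  have hsq : ∀ n : ℤ, n ∈ ({1, -6, -159, 106} : Finset ℤ) → IsSquare ((n : ℤ) : ℚ_[5]) := by
    intro n hn
    simp only [Finset.mem_insert, Finset.mem_singleton] at hn
    rcases hn with rfl | rfl | rfl | rfl
    · exact ⟨1, by norm_num⟩
    · exact padic_isSquare_intCast (by norm_num) h1 h1'
    · exact padic_isSquare_intCast (by norm_num) h2 h2'
    · exact padic_isSquare_intCast (by norm_num) h3 h3'
  apply hsq
  revert D
  decide

/-- **`p = 53`**: the kernel `{1, -6, -15, 10}` of `χ_{(0,0,1)}` consists of squares in `ℚ₅₃`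
(`-6 ≡ 10², -15 ≡ 12², 10 ≡ 13² mod 53`; Hensel). [cite: Serre1973, Ch. II §3.3 Thm 3] -/
theorem cn_padic_ker_isSquare_53 [Fact (Nat.Prime 53)] :
    ∃ c : CNIdx, ∀ D, cnChi c D = 0 → IsSquare ((cnParam D : ℤ) : ℚ_[53]) := by
  obtain ⟨⟨h1, h1'⟩, ⟨h2, h2'⟩, ⟨h3, h3'⟩⟩ := cn_zmod53_squares
  refine ⟨(0, 0, 1), fun D hD ↦ ?_⟩
  have hsq : ∀ n : ℤ, n ∈ ({1, -6, -15, 10} : Finset ℤ) → IsSquare ((n : ℤ) : ℚ_[53]) := by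
    intro n hn
    simp only [Finset.mem_insert, Finset.mem_singleton] at hn
    rcases hn with rfl | rfl | rfl | rfl
    · exact ⟨1, by norm_num⟩
    · exact padic_isSquare_intCast (by norm_num) h1 h1'
    · exact padic_isSquare_intCast (by norm_num) h2 h2'
    · exact padic_isSquare_intCast (by norm_num) h3 h3'
  apply hsq
  revert D
  decide

/-- **`p = 2`**: the odd classes `1, -15, -159, 265 ≡ 1 (mod 8)` — the kernel of `χ_{(1,0,0)}` —
are squares in `ℚ₂` (Serre II.3.3 Thm. 4; tree `KramerLocal.padicTwo_isSquare_intCast`).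
[cite: Serre1973, Ch. II §3.3 Thm 4] -/
theorem cn_padic_ker_isSquare_two :
    ∃ c : CNIdx, ∀ D, cnChi c D = 0 → IsSquare ((cnParam D : ℤ) : ℚ_[2]) := by
  refine ⟨(1, 0, 0), fun D hD ↦ ?_⟩
  have hsq : ∀ n : ℤ, n ∈ ({1, -15, -159, 265} : Finset ℤ) → IsSquare ((n : ℤ) : ℚ_[2]) := by
    intro n hn
    simp only [Finset.mem_insert, Finset.mem_singleton] at hn
    rcases hn with rfl | rfl | rfl | rfl
    · exact padicTwo_isSquare_intCast ⟨0, by norm_num⟩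
    · exact padicTwo_isSquare_intCast ⟨-2, by norm_num⟩
    · exact padicTwo_isSquare_intCast ⟨-20, by norm_num⟩
    · exact padicTwo_isSquare_intCast ⟨33, by norm_num⟩
  apply hsq
  revert D
  decide

/-- **Every prime `p`**: some character of the index group has kernel consisting of `D` with
`d(D) ∈ ℚ_p^{×2}` — the image of `⟨-6, -15, -159⟩` in `ℚ_p^×/ℚ_p^{×2}` has order `≤ 2`, i.e.
every prime of `ℚ` splits into a multiple of `4` primes of `ℚ(√-6, √-15, √-159)`.
[cite: DokchitserDokchitser2011RankModN, Lemma 5] -/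
theorem cn_padic_ker_isSquare (p : ℕ) [Fact p.Prime] :
    ∃ c : CNIdx, ∀ D, cnChi c D = 0 → IsSquare ((cnParam D : ℤ) : ℚ_[p]) := by
  by_cases hp2 : p = 2
  · subst hp2; exact cn_padic_ker_isSquare_two
  by_cases hp3 : p = 3
  · subst hp3; exact cn_padic_ker_isSquare_3
  by_cases hp5 : p = 5
  · subst hp5; exact cn_padic_ker_isSquare_5
  by_cases hp53 : p = 53
  · subst hp53; exact cn_padic_ker_isSquare_53
  exact cn_padic_ker_isSquare_of_ne p hp2 hp3 hp5 hp53

/-- **The real place**: the positive classes `1, 10, 106, 265` — the kernel of `χ_{(1,1,1)}` —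
are squares in `ℝ`. [folklore] -/
theorem cn_real_ker_isSquare :
    ∃ c : CNIdx, ∀ D, cnChi c D = 0 → IsSquare ((cnParam D : ℤ) : ℝ) := by
  refine ⟨(1, 1, 1), fun D hD ↦ ?_⟩
  have hsq : ∀ n : ℤ, n ∈ ({1, 10, 106, 265} : Finset ℤ) → IsSquare ((n : ℤ) : ℝ) := by
    intro n hn
    simp only [Finset.mem_insert, Finset.mem_singleton] at hn
    rcases hn with rfl | rfl | rfl | rfl <;> exact real_isSquare_intCast (by norm_num)
  apply hsq
  revert D
  decide

end Padic

end CongruentDescent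

end Literature.Barriers.BirchSwinnertonDyer

end
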